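import Summits.QuantumFields.YangMills.Theorems.BalabanUVNodesN18HLayerW1TermDatum
import Summits.QuantumFields.BalabanUV.T4Continuum.Spine.NE5.TwoRunTorusWalkParam
import Literature.Analysis.Complex.HolomorphicBanach

/-!
# BalabanUVNodes ∕ N18 — (T-an) + (T-226) AT node00-def-W1's (2.14) TERM DATUM FROM NODE A's WALK RECORD `TermWalkData` READ AT THE
# CONFIGURATION: the nine kernel letters of file 26 (localisation (L17a), (2.16)-differences (L16a), holomorphy in the configuration) DISCHARGED
# from ONE record `TermWalkData ((𝔇).𝒦 Z t) w` at `c⁺` and the reading map `uOf Z t` (Track A, DAG node N18 = NE5 `T4OutputRate.NE5 EA EB W κ θ C₅`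
# :211; cluster K4 «SpineRates»; file 27 of seat pub-ymgap-dag-n18-c, row s1 «the H-layer activity datum on the record's torus catalogue», generation 6)

Cell `pub-ymgap`, HUMAN RULING D-0062 (Track A), R134 ACCELERATION seat `pub-ymgap-dag-n18-c` (strategy s1 = first missing estimate), generation 6.
THEOREMS ONLY (no `def`, no `instance`, no `sorry`); imports file 25 `…N18HLayerW1TermDatum` (files 23 ∕ 24, W1's STOREY 7 `Node00/HistoryTermDatum214`), the
cell `pub-balaban-gaps` junction T25 `Spine/NE5/TwoRunTorusWalkParam` (engine T21 `TwoRunTorusPrimitiveParam`, the (J1) glue `sigma_region_glue`, NODE A's record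
file `B13TermWalkData`) and `Literature/Analysis/Complex/HolomorphicBanach` ([Chae1985] Thm 14.13); restates nothing.

WHY.  File 26 (`…N18HLayerW1TermAnalytic`) DISCHARGED files 23 ∕ 25's last analytic binder (T-an) («(2.14) analytic in the configuration», [II] p. 15) together
with (T-226) from ONE list of located PRIMITIVE inputs along the configuration, nine of which are kernel letters at the configuration `u = uOf Z t φ`:
(L17a) `hG hΓ₀ hCs hC216`, (L16a) `hdΓ hdC hdE`, and the holomorphy IN `φ` of `A(σ, uOf φ)`, `G(σ, uOf φ)`.  These nine are exactly what NODE A's typed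
deliverable — ONE walk record `TermWalkData (𝒦 Z t) w` of the term's kernels ([II] p. 13 ∕ p. 15, [B9] Thm 3.10; the tree's capstones
`localisation17a_of_termWalkData`, `differences216_of_termWalkData`, `JointWalkExpansion.analyticOnBall`) — produces at every configuration `u` of the
`α`-ball, the last one COMPOSED WITH THE READING MAP `φ ↦ uOf Z t φ` (chain rule).  The cell's junction T25 executes this read-off in the DATA direction
(kernels over the parameter space itself, `V := ball 0 α`); THIS FILE executes it AT node00-def-W1's (2.14) DATUM IN THE CONFIGURATION DIRECTION: the
datum's kernels live at `c⁺ := {c with κ₁ := κ₁ + 1}` (the (J1) glue of T25 — walk road at `c⁺`, σ-region `ball 0 e^{κ₁+1}`; W1's two-record split «the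
datum's own record keys only its kernel tower, `TF` is record-free»), the estimate and the weights at `c`, the table `V` any OPEN set of configurations mapped
by `uOf Z t` holomorphically into the `α`-ball.  What remains displayed per term is then legible and belongs to other lanes: σ-holomorphy of the kernels
(NODE O: the linear interpolations (2.4)–(2.6)), symmetry ∕ `Re ≻ 0` of the precision (NODE A, [II] p. 15), LEMMA 2's potentials along the history
(holomorphic in `φ`, measurable, (2.20) on the τ-regions, under the (1.18) guard), `χ`, `χᶜ` with (2.22), a fibre bound, NODE A's smallness `SmallTheta`,
the numerics — and whether Bałaban's kernels of record ADMIT such walk records with one package is NODE O's statement (v), not claimed here.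

WHAT (theorems only).  §1 ONE TERM of `𝔇 : W1.TermDatum214 c⁺ P 𝔸 M k L`, any open `V`: `holAnd226_TF_of_termWalkData_param` (T21 §2 at `B := CPair P 𝔸`,
the nine binders read from the record — T25's proof pattern, `b ↦ uOf Z t φ`), ★ `analyticOnNhd_TF_of_termWalkData_param` (Chae).  §2 A DATUM FAMILY ALONG
THE HISTORY (one package `w`, a record and a reading map per term; located inputs as section variables under the (1.18) guard): `holAnd226_TF_of_termWalkData`,
★★ `termwiseAn_TF_of_termWalkData` — file 23's `hTan` binder type VERBATIM on every `sp₁ ⊆ big`, PROVED.  §3 ★ `recAdmissible_Gn_of_termWalkData` — W1's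
`RecAdmissible` for `𝔇.Gn` (file 23, BOTH schema binders discharged): the induction closes from NODE A's records + reading maps + Lemma 2 + numerics.

HONEST FRAMING — what this is NOT.  Compositions of LANDED theorems (T21 §2, `B13TermWalkData` §2 capstones, rate monotonicity, Chae 14.13, file 23);
NO estimate of Bałaban's is proved here; every record, map, region and number is a HYPOTHESIS; nothing of `C^{(k)}(Z₀,σ)`, `Γ_k(Z₀,σ)`, `𝐕_k` is
constructed.  Count-neutral; NOT a discharge of N18 (typed 28∕28 · discharged 5∕27 UNCHANGED); NE5 NOT IN PRINT ([I] Thm 1 p. 259) and NOT PROVED.  One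
finite four-torus programme at fixed `ε`, Bałaban as printed — NOT ℝ⁴, NOT infinite volume, NOT OS, NOT a mass gap, NOT Clay.  0 `sorry`, 0 `def`.

References (TYPES ∕ loci only): [II] = [Balaban1988RG2Cluster] CMP **116** (1988) — p. 5 (κ₁), (1.41) p. 11, p. 13, (2.14)–(2.16) pp. 15–16 and the
analyticity statement p. 15, (2.20)–(2.26) pp. 16–17, Lemma 3 p. 20, p. 22; [I] = [Balaban1987RG1] CMP **109** (1987) — (1.18) p. 263, Thm 1 p. 259;
[B9] = [Balaban1985BackgroundPropagators] CMP **99** (1985) Thm 3.10 p. 416; [Chae1985] Thm 14.13.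
-/

noncomputable section

open scoped Classical

namespace Summit.QuantumFields.YangMills.BalabanUVNodes.N18HLayerW1TermWalkRecord

open Set Metric
open scoped BigOperators Matrix Matrix.Norms.L2Operator
open Literature.MathematicalPhysics.QuantumFieldTheory.Balaban1983to89
open Literature.MathematicalPhysics.QuantumFieldTheory.Balaban1983to89.T4Continuum (T4Family)
open Literature.MathematicalPhysics.QuantumFieldTheory.Balaban1983to89.TreeLengthTorus (TDom TPt tsys)
open Literature.MathematicalPhysics.QuantumFieldTheory.Balaban1983to89.B12TreeDecay (K₀)
open Literature.MathematicalPhysics.QuantumFieldTheory.Balaban1983to89.B13Lemma3TorusTerms (terms weight)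
open Literature.MathematicalPhysics.QuantumFieldTheory.Balaban1983to89.B13Lemma3TorusSocket (Lemma3Numerics)
open Literature.MathematicalPhysics.QuantumFieldTheory.Balaban1983to89.B13Bound143 (invTau)
open Literature.MathematicalPhysics.QuantumFieldTheory.Balaban1983to89.B9Thm37GlueTorus (tdist1)
open Literature.MathematicalPhysics.QuantumFieldTheory.Balaban1983to89.B5TorusCover (UT)
open Literature.MathematicalPhysics.QuantumFieldTheory.Balaban1983to89.B13PrimitiveKernels216
  (Localisation17a Differences216 localisation17a_mono_rate)
open Literature.MathematicalPhysics.QuantumFieldTheory.Balaban1983to89.B13TermWalkData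
  (WalkConsts TermKernels TermWalkData localisation17a_of_termWalkData differences216_of_termWalkData)
open Literature.MathematicalPhysics.QuantumFieldTheory.Balaban1983to89.B13TermWalkDataOneTorus (SmallTheta)
open Literature.MathematicalPhysics.QuantumFieldTheory.Balaban1983to89.Node00
open Literature.MathematicalPhysics.QuantumFieldTheory.Balaban1983to89.Node00.Sect2 (domSys domCount CPair)
open Literature.MathematicalPhysics.QuantumFieldTheory.Balaban1983to89.Node00.W1
open Literature.Analysis.Complex.HolomorphicBanach (analyticOnNhd_of_differentiableOn)
open Summit.QuantumFields.BalabanUV.T4Continuum.Spine.NE5.TwoRunTorusPrimitiveParam (hol_and_h226_torus_of_primitives_param)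
open Summit.QuantumFields.BalabanUV.T4Continuum.Spine.NE5.TwoRunTorusWalkH226 (sigma_region_glue)
open Summit.QuantumFields.YangMills.BalabanUVNodes.N18HLayerW1TermIndexed (recAdmissible_ofTerms_of_termwise)

/-! ## §1 One term of a datum at `c⁺`: holomorphy in the configuration on an open table + (2.26) there, the kernel letters read from the walk record -/

section OneTerm

variable {c : B13.Consts} {P : Params} {𝔸 : Type} [NormedRing 𝔸] [NormedAlgebra ℂ 𝔸] {M k L : ℕ} [NeZero L]
  (𝔇 : TermDatum214 ({ c with κ₁ := c.κ₁ + 1 } : B13.Consts) P 𝔸 M k L)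

variable (hκ₁ : 1 ≤ c.κ₁) (hα₆ : c.α₆ ≠ 0)
    (Z : (domSys P M (k + 1)).Dom) (t : TermLabel P M k L) (s : ℂ) (old : OlderTerms P 𝔸 M k)
    {V : Set (CPair P 𝔸)} (hV : IsOpen V)
    (hpos : ∀ Y : TDom P.d (L * domCount P M (k + 1)), 0 < invTau c ((tsys P.d (L * domCount P M (k + 1))).dj Y))
    (hhalf : ∀ Y : TDom P.d (L * domCount P M (k + 1)), invTau c ((tsys P.d (L * domCount P M (k + 1))).dj Y) ≤ 1 / 2)
    -- the PER-DOMAIN τ-regions (print's radii (2.18)) and the contour radius of the datum; the σ-region is `ball 0 e^{κ₁+1}` (the (J1) glue)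
    {Uτ : TDom P.d (L * domCount P M (k + 1)) → Set ℂ} (hUτ : ∀ Y, IsOpen (Uτ Y))
    (hUtau : ∀ Y : TDom P.d (L * domCount P M (k + 1)),
      closedBall (0 : ℂ) ((invTau c ((tsys P.d (L * domCount P M (k + 1))).dj Y))⁻¹) ⊆ Uτ Y)
    (hr : 0 < 𝔇.r) (hr' : 𝔇.r ≤ Real.exp c.κ₁ - 1)
    (hsubτ : ∀ Y, ∀ x ∈ Set.uIcc (0 : ℝ) 1, closedBall (x : ℂ) 𝔇.r ⊆ Uτ Y)
    -- NODE A's WALK RECORD of the term's kernels at `c⁺`, ONE admissible small package; THE READING MAP holomorphic on the table into the `α`-ball ([II] p. 15)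
    {w : WalkConsts} {α Rσ₀ : ℝ} (hw : w.Admissible α Rσ₀) (hα : 0 < α)
    -- the last line at the coupling: signs and measurability of χ, χᶜ
    (hχ0 : ∀ B, 0 ≤ 𝔇.chiY₀ Z t s B) (hχc0 : ∀ B, 0 ≤ 𝔇.chicP Z t s B)
    (hχm : Measurable (𝔇.chiY₀ Z t s)) (hχcm : Measurable (𝔇.chicP Z t s))
    -- NOT walk data: σ-holomorphy of the kernels on the open `e^{κ₁+1}`-polydisc (NODE O), symmetry ∕ `Re ≻ 0` on the closed `c⁺`-polydisc (NODE A)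
    (hAhol : ∀ φ ∈ V, ∀ i j, DifferentiableOn ℂ (fun σ => 𝔇.A Z t φ σ i j) {σ | ∀ j, σ j ∈ ball (0 : ℂ) (Real.exp (c.κ₁ + 1))})
    (hGhol : ∀ φ ∈ V, ∀ i j,
      DifferentiableOn ℂ (fun σ => (𝔇.𝒦 Z t).G2 σ (𝔇.uOf Z t φ) i j) {σ | ∀ j, σ j ∈ ball (0 : ℂ) (Real.exp (c.κ₁ + 1))})
    (hAs : ∀ φ ∈ V, ∀ σ : TPt P.d (domCount P M (k + 1)) → ℂ, (∀ j, ‖σ j‖ ≤ Real.exp (c.κ₁ + 1)) → (𝔇.A Z t φ σ).IsSymm)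
    (hA : ∀ φ ∈ V, ∀ σ : TPt P.d (domCount P M (k + 1)) → ℂ, (∀ j, ‖σ j‖ ≤ Real.exp (c.κ₁ + 1)) →
      ((𝔇.A Z t φ σ).map Complex.re).PosDef)
    -- LEMMA 2 at (coupling, history): the potentials holomorphic IN φ on the table, measurable in the row-bond field, (2.20) on `Π_Y Uτ Y`
    (hVholφ : ∀ Y B, DifferentiableOn ℂ (fun φ => 𝔇.𝒱 Z t s old φ Y B) V)
    (hVm : ∀ φ ∈ V, ∀ Y, Measurable (𝔇.𝒱 Z t s old φ Y))
    {γ₂ rP a₂₀ w₂₀ : ℝ} (qP : ((𝔇.𝒦 Z t).Λ → ℝ) → ℝ)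
    (h222 : ∀ B, 𝔇.chiY₀ Z t s B * 𝔇.chicP Z t s B ≤ Real.exp (-(γ₂ / 2 * rP ^ 2 * (t.2.card : ℕ)) + γ₂ / 2 * qP B)) (hγ₂ : 0 ≤ γ₂)
    (hqP : ∀ B, qP B ≤ B ⬝ᵥ B) (ha0 : 0 ≤ a₂₀)
    (h220U : ∀ φ ∈ V, ∀ τ : TDom P.d (L * domCount P M (k + 1)) → ℂ, (∀ Y, τ Y ∈ Uτ Y) →
      ∀ B, ∑ Y ∈ t.1, ‖τ Y‖ * ‖𝔇.𝒱 Z t s old φ Y B‖ ≤ a₂₀ / 2 * (B ⬝ᵥ B) + w₂₀)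
    -- a common fibre bound for row and column locations (the record's `hfib` bounds the rows by `(𝒦 Z t).m`)
    {m : ℕ} (hm : (𝔇.𝒦 Z t).m ≤ m) (hfibN : ∀ x : UT 𝔇.Nf, (Finset.univ.filter fun j => (𝔇.𝒦 Z t).locN j = x).card ≤ m)
    -- rates: the record's torus rate `w.κ`, two drops for (L16a), two more for the (2.26) chain
    {κa κb kap' kap'' θ : ℝ} (hκa : κa < w.kap) (hκb : κb < κa) (h2 : kap' < κb) (h1 : kap'' < kap') (hkap'' : 0 < kap'')
    -- NODE A's smallness BY NAME: `θ_Γ, θ_E ≤ θ` with `θ_• = 2K̄_•(e^{−εR_σ} + α∕R)`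
    (hsm : SmallTheta w α θ)
    (hθR1le : (m * (1 + 2 / (κb - kap')) ^ 𝔇.ν) * (m * (1 + 2 / (kap' - kap'')) ^ 𝔇.ν)
      * ((2 * w.KbarΓ * Real.exp (-(w.ε * w.Rσ)) + 2 * w.KbarΓ * α / w.R) * w.KbarC * w.KbarΓ
        + w.KbarΓ * (w.KbarC * (2 * w.KbarE * Real.exp (-(w.ε * w.Rσ)) + 2 * w.KbarE * α / w.R)
            * ((𝔇.𝒦 Z t).m * (1 + 2 / (w.kap - κa)) ^ 𝔇.ν) * w.KbarC * ((𝔇.𝒦 Z t).m * (1 + 2 / (κa - κb)) ^ 𝔇.ν)) * w.KbarΓ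
        + w.KbarΓ * w.KbarC * (2 * w.KbarΓ * Real.exp (-(w.ε * w.Rσ)) + 2 * w.KbarΓ * α / w.R)) ≤ θ)
    (hsmallKθ : w.KbarC * (m * (1 + 2 / κb) ^ 𝔇.ν) * (θ * (m * (1 + 2 / kap'') ^ 𝔇.ν)) < 1)
    {cE g : ℝ} (hc0 : 0 ≤ cE) (hc : ∀ i, (𝔇.𝒦 Z t).hC.1.eigenvalues i ≤ cE)
    (hαc : (2 * (θ * (m * (1 + 2 / kap'') ^ 𝔇.ν)) + (γ₂ + a₂₀)) * cE ≤ 1 / 2) (hg : 0 ≤ g)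
    (hΓq : ∀ X : (𝔇.𝒦 Z t).Λ ⊕ (𝔇.𝒦 Z t).C₀ → ℝ,
      ((𝔇.𝒦 Z t).Γ₀ *ᵥ X) ⬝ᵥ ((𝔇.𝒦 Z t).C *ᵥ ((𝔇.𝒦 Z t).Γ₀ *ᵥ X)) ≤ g * (X ⬝ᵥ X))
    (hsmall : (2 * (θ * (m * (1 + 2 / kap'') ^ 𝔇.ν)) + (γ₂ + a₂₀)) * (1 + 2 * cE * g) ≤ 1 / 2)
    {a a₅ : ℝ} (hPa : a ≤ γ₂ * rP ^ 2)
    (hvol : 2 * (w.KbarC * (m * (1 + 2 / κb) ^ 𝔇.ν) * (θ * (m * (1 + 2 / kap'') ^ 𝔇.ν))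
              * (1 + (1 - w.KbarC * (m * (1 + 2 / κb) ^ 𝔇.ν) * (θ * (m * (1 + 2 / kap'') ^ 𝔇.ν)))⁻¹) / 2)
          * (Fintype.card (𝔇.𝒦 Z t).Λ : ℝ)
        + w₂₀ + (2 * (θ * (m * (1 + 2 / kap'') ^ 𝔇.ν)) + (γ₂ + a₂₀)) * cE * (Fintype.card (𝔇.𝒦 Z t).Λ : ℝ)
        + (2 * (θ * (m * (1 + 2 / kap'') ^ 𝔇.ν)) + (γ₂ + a₂₀)) * (1 + 2 * cE * g) * (Fintype.card ((𝔇.𝒦 Z t).Λ ⊕ (𝔇.𝒦 Z t).C₀) : ℝ)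
        ≤ a₅ * ((Z.1).card : ℝ))

include hκ₁ hα₆ hV hpos hhalf hUτ hUtau hr hr' hsubτ hw hα hχ0 hχc0 hχm hχcm hAhol hGhol hAs hA hVholφ hVm h222 hγ₂ hqP ha0 h220U
  hm hfibN hκa hκb h2 h1 hkap'' hsm hθR1le hsmallKθ hc0 hc hαc hg hΓq hsmall hPa hvol

/-- **(T-an) ∧ (T-226) FOR ONE TERM OF THE DATUM ON AN OPEN CONFIGURATION TABLE, THE KERNEL LETTERS READ FROM NODE A's WALK RECORD** — file 26's
`differentiableOn_and_norm_TF_of_primitives_param` (the engine `TwoRunTorusPrimitiveParam.hol_and_h226_torus_of_primitives_param` at `B := CPair P 𝔸`,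
`b := φ`, for `𝔇.TF Z t g old φ = term214 r (Z∖Z′₀) 𝐃 (core214 (A φ) (Γ φ) (F214 |P| χ χᶜ 𝐃 (𝐕 φ))) 0 0`, `rfl`) with its nine kernel binders DISCHARGED
from ONE record `TermWalkData (𝒦 Z t) w` of the term's kernels at `c⁺ := {c with κ₁ := κ₁ + 1}` read at the configuration `u = uOf Z t φ`: (L17a)
`hG hΓ₀ hCs hC216` by `localisation17a_of_termWalkData` (dropped to the rate `κ_b`), (L16a) `hdΓ hdC hdE` by `differences216_of_termWalkData`, holomorphy
IN `φ` `hAholφ hGholφ` by the records' joint walk expansions (`JointWalkExpansion.analyticOnBall`, [B9] Thm 3.10) COMPOSED WITH THE READING MAP (chain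
rule) — the (J1) glue as in T25 `TwoRunTorusWalkParam`: walk road at `c⁺`, σ-region `ball 0 e^{κ₁+1}`.  What remains: the reading map holomorphic on the
table into the `α`-ball; σ-holomorphy of the kernels (NODE O); symmetry ∕ `Re ≻ 0` (NODE A); LEMMA 2's potentials (holomorphic in `φ`, measurable, (2.20));
`χ`, `χᶜ` with (2.22); the fibre bound; NODE A's smallness `SmallTheta w α θ`; the numerics of (2.24)–(2.26) in the record's letters.  Conclusion:
`φ ↦ 𝔇.TF Z t g old φ` is `DifferentiableOn ℂ` on `V` AND (2.26) (weights at `c`) holds at every `φ ∈ V`.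
[cite: Balaban1988RG2Cluster, p.5 (κ₁), p.13, (2.14)-(2.16) pp.15-16 and the analyticity statement p.15, (2.20)-(2.26) pp.16-17; Balaban1985BackgroundPropagators, Thm 3.10 p.416] -/
theorem holAnd226_TF_of_termWalkData_param (h𝒦 : TermWalkData (𝔇.𝒦 Z t) w)
    (huOf : DifferentiableOn ℂ (𝔇.uOf Z t) V) (hmaps : MapsTo (𝔇.uOf Z t) V (ball (0 : 𝔇.E₃) α)) :
    DifferentiableOn ℂ (fun φ => 𝔇.TF Z t s old φ) V ∧
      ∀ φ ∈ V, ‖𝔇.TF Z t s old φ‖ ≤ weight L M c Z a t * Real.exp (a₅ * ((Z.1).card : ℝ)) := by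
  -- the (J1) glue: open σ-region of radius `e^{κ₁+1}` between the two closed polydiscs
  obtain ⟨hUσ, hUexp, hcl⟩ := sigma_region_glue (d := P.d) (N' := domCount P M (k + 1)) c
  have hκb0 : 0 ≤ κb := (hkap''.trans (h1.trans h2)).le
  have hκbw : κb ≤ w.kap := (hκb.trans hκa).le
  have hR0 : 0 < w.R := hα.trans hw.hαR
  have huα : ∀ φ ∈ V, ‖𝔇.uOf Z t φ‖ ≤ α := fun φ hφ => (mem_ball_zero_iff.1 (hmaps hφ)).le
  have huR : ∀ φ ∈ V, 𝔇.uOf Z t φ ∈ ball (0 : 𝔇.E₃) w.R := fun φ hφ => ball_subset_ball hw.hαR.le (hmaps hφ)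
  -- L17a at every configuration of the table (dropped to `κb`), and at `u = 0` for the `u`-free references `Γ₀`, `C`; L16a likewise (NODE A's `hAs hA`)
  have h17 : ∀ φ ∈ V, Localisation17a ({ c with κ₁ := c.κ₁ + 1 } : B13.Consts) (fun σ => (𝔇.𝒦 Z t).A2 σ (𝔇.uOf Z t φ))
      (fun σ => (𝔇.𝒦 Z t).G2 σ (𝔇.uOf Z t φ)) (𝔇.𝒦 Z t).Γ₀ (𝔇.𝒦 Z t).C (𝔇.𝒦 Z t).locΛ (𝔇.𝒦 Z t).locN κb
      w.KbarΓ w.KbarΓ w.KbarC w.KbarC := fun φ hφ =>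
    localisation17a_mono_rate hκbw hw.hKbarΓ hw.hKbarΓ hw.hKbarC hw.hKbarC (localisation17a_of_termWalkData hw hα.le h𝒦 (huR φ hφ))
  have h17₀ : Localisation17a ({ c with κ₁ := c.κ₁ + 1 } : B13.Consts) (fun σ => (𝔇.𝒦 Z t).A2 σ 0)
      (fun σ => (𝔇.𝒦 Z t).G2 σ 0) (𝔇.𝒦 Z t).Γ₀ (𝔇.𝒦 Z t).C (𝔇.𝒦 Z t).locΛ (𝔇.𝒦 Z t).locN κb
      w.KbarΓ w.KbarΓ w.KbarC w.KbarC :=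
    localisation17a_mono_rate hκbw hw.hKbarΓ hw.hKbarΓ hw.hKbarC hw.hKbarC (localisation17a_of_termWalkData hw hα.le h𝒦 (mem_ball_self hR0))
  have h16 : ∀ φ ∈ V, Differences216 ({ c with κ₁ := c.κ₁ + 1 } : B13.Consts) (fun σ => (𝔇.𝒦 Z t).A2 σ (𝔇.uOf Z t φ))
      (fun σ => (𝔇.𝒦 Z t).G2 σ (𝔇.uOf Z t φ)) (𝔇.𝒦 Z t).Γ₀ (𝔇.𝒦 Z t).C (𝔇.𝒦 Z t).locΛ (𝔇.𝒦 Z t).locN κb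
      (2 * w.KbarΓ * Real.exp (-(w.ε * w.Rσ)) + 2 * w.KbarΓ * α / w.R)
      (w.KbarC * (2 * w.KbarE * Real.exp (-(w.ε * w.Rσ)) + 2 * w.KbarE * α / w.R)
        * ((𝔇.𝒦 Z t).m * (1 + 2 / (w.kap - κa)) ^ 𝔇.ν) * w.KbarC * ((𝔇.𝒦 Z t).m * (1 + 2 / (κa - κb)) ^ 𝔇.ν))
      (2 * w.KbarE * Real.exp (-(w.ε * w.Rσ)) + 2 * w.KbarE * α / w.R) := fun φ hφ =>
    differences216_of_termWalkData hw hα.le h𝒦 hκb0 hκb hκa (huα φ hφ) (hAs φ hφ) (hA φ hφ)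
  -- holomorphy IN THE CONFIGURATION: the joint walk expansions' analyticity in `u` ([B9] Thm 3.10) ∘ the reading map (chain rule)
  obtain ⟨WΓ, TΓ, SXΓ, AΓ, DΓ, ρΓ, hΓw⟩ := h𝒦.hΓ
  obtain ⟨WE, TE, SXE, AE, DE, ρE, hEw⟩ := h𝒦.hE
  have hmapsR : MapsTo (𝔇.uOf Z t) V (ball (0 : 𝔇.E₃) w.R) := hmaps.mono_right (ball_subset_ball hw.hαR.le)
  have hAholφ : ∀ σ : TPt P.d (domCount P M (k + 1)) → ℂ, (∀ j, σ j ∈ ball (0 : ℂ) (Real.exp (c.κ₁ + 1))) →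
      ∀ i j, DifferentiableOn ℂ (fun φ => 𝔇.A Z t φ σ i j) V := fun σ hσ i j =>
    ((hEw.analyticOnBall hw.hε) σ (hcl σ hσ) i j).comp huOf hmapsR
  have hGholφ : ∀ σ : TPt P.d (domCount P M (k + 1)) → ℂ, (∀ j, σ j ∈ ball (0 : ℂ) (Real.exp (c.κ₁ + 1))) →
      ∀ i j, DifferentiableOn ℂ (fun φ => (𝔇.𝒦 Z t).G2 σ (𝔇.uOf Z t φ) i j) V := fun σ hσ i j =>
    ((hΓw.analyticOnBall hw.hε) σ (hcl σ hσ) i j).comp huOf hmapsR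
  have hθΓ0 : 0 ≤ 2 * w.KbarΓ * Real.exp (-(w.ε * w.Rσ)) + 2 * w.KbarΓ * α / w.R := by
    have := hw.hKbarΓ; positivity
  have hθE0 : 0 ≤ 2 * w.KbarE * Real.exp (-(w.ε * w.Rσ)) + 2 * w.KbarE * α / w.R := by
    have := hw.hKbarE; positivity
  have hθC0 : 0 ≤ w.KbarC * (2 * w.KbarE * Real.exp (-(w.ε * w.Rσ)) + 2 * w.KbarE * α / w.R)
      * ((𝔇.𝒦 Z t).m * (1 + 2 / (w.kap - κa)) ^ 𝔇.ν) * w.KbarC * ((𝔇.𝒦 Z t).m * (1 + 2 / (κa - κb)) ^ 𝔇.ν) := by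
    have := hw.hKbarC; have := hw.hKbarE
    have h1' : 0 < w.kap - κa := sub_pos.2 hκa
    have h2' : 0 < κa - κb := sub_pos.2 hκb
    positivity
  have hfibΛ : ∀ x : UT 𝔇.Nf, (Finset.univ.filter fun i => (𝔇.𝒦 Z t).locΛ i = x).card ≤ m := fun x => ((𝔇.𝒦 Z t).hfib x).trans hm
  have hθEle : 2 * w.KbarE * Real.exp (-(w.ε * w.Rσ)) + 2 * w.KbarE * α / w.R ≤ θ := (Eq.trans_le (by ring) hsm.hE)
  have hθΓle : 2 * w.KbarΓ * Real.exp (-(w.ε * w.Rσ)) + 2 * w.KbarΓ * α / w.R ≤ θ := (Eq.trans_le (by ring) hsm.hΓ)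
  exact hol_and_h226_torus_of_primitives_param c hκ₁ hα₆ Z t hpos hhalf hUσ hUτ hUexp hUtau hr hr' hsubτ
    (sigmaList L Z t) (sigmaList_spec Z t) (tauList P M k L t) (tauList_spec t) hV
    (fun φ => 𝔇.A Z t φ) (fun φ => 𝔇.Gam Z t φ) (fun φ σ => (𝔇.𝒦 Z t).G2 σ (𝔇.uOf Z t φ))
    (𝔇.chiY₀ Z t s) (𝔇.chicP Z t s) hχ0 hχc0 t.1 (fun φ => 𝔇.𝒱 Z t s old φ) (𝔇.𝒦 Z t).hC (𝔇.𝒦 Z t).Γ₀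
    hAhol hGhol hAholφ hGholφ hVholφ hχm hχcm hVm (fun φ hφ σ hσ => hAs φ hφ σ (hcl σ hσ))
    (fun φ hφ σ hσ => hA φ hφ σ (hcl σ hσ)) (fun _ _ _ _ _ => rfl)
    qP h222 hγ₂ hqP ha0 h220U (𝔇.𝒦 Z t).locΛ (𝔇.𝒦 Z t).locN hfibΛ hfibN
    hkap'' h1 h2 hθE0 hθΓ0 hθC0 hw.hKbarΓ hw.hKbarΓ hw.hKbarC hw.hKbarC hθEle hθΓle hθR1le
    (fun φ hφ σ hσ => (h17 φ hφ).hG σ (hcl σ hσ)) h17₀.hΓ₀ (fun φ hφ σ hσ => (h17 φ hφ).hCs σ (hcl σ hσ)) h17₀.hC216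
    (fun φ hφ σ hσ => (h16 φ hφ).hdΓ σ (hcl σ hσ)) (fun φ hφ σ hσ => (h16 φ hφ).hdC σ (hcl σ hσ))
    (fun φ hφ σ hσ => (h16 φ hφ).hdE σ (hcl σ hσ)) hsmallKθ hc0 hc hαc hg hΓq hsmall hPa hvol

/-- **★ (T-an) FOR ONE TERM OF THE DATUM FROM NODE A's WALK RECORD READ AT THE CONFIGURATION** — print's «analytic function of (𝐔, 𝐉) … by
inspection of (2.14)» as a theorem keyed on the walk record: under §1's inputs `φ ↦ 𝔇.TF Z t g old φ` is ANALYTIC at every point of the open table `V`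
([Chae1985] Thm 14.13 on the complex normed space `CPair P 𝔸`). [cite: Balaban1988RG2Cluster, (2.14) p.15 and the analyticity statement p.15, p.13; Chae1985, Thm 14.13] -/
theorem analyticOnNhd_TF_of_termWalkData_param (h𝒦 : TermWalkData (𝔇.𝒦 Z t) w)
    (huOf : DifferentiableOn ℂ (𝔇.uOf Z t) V) (hmaps : MapsTo (𝔇.uOf Z t) V (ball (0 : 𝔇.E₃) α)) :
    AnalyticOnNhd ℂ (fun φ => 𝔇.TF Z t s old φ) V :=
  analyticOnNhd_of_differentiableOn
    (holAnd226_TF_of_termWalkData_param 𝔇 hκ₁ hα₆ Z t s old hV hpos hhalf hUτ hUtau hr hr' hsubτ hw hα hχ0 hχc0 hχm hχcm hAhol hGhol hAs hA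
      hVholφ hVm qP h222 hγ₂ hqP ha0 h220U hm hfibN hκa hκb h2 h1 hkap'' hsm hθR1le hsmallKθ hc0 hc hαc hg hΓq hsmall hPa hvol h𝒦 huOf hmaps).1 hV

end OneTerm

/-! ## §2 A datum family at `c⁺` along the history: (T-an) and (T-226) on the open located-inputs tables from the walk records + the reading maps -/

section Located

variable (F : T4Family) (K : ℕ) {𝔸 : Type} [NormedRing 𝔸] [NormedAlgebra ℂ 𝔸] {M : ℕ} [NeZero M] (L : ℕ) [NeZero L]
  {c : B13.Consts} (𝔇 : TermData214 ({ c with κ₁ := c.κ₁ + 1 } : B13.Consts) (F.P K) 𝔸 M L) (D : Set ℂ)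
  (sp big : (j : ℕ) → (domSys (F.P K) M j).Dom → Set (CPair (F.P K) 𝔸)) {E₀ r₁ : ℝ}
  -- the located-inputs tables are OPEN (print's analyticity space with the larger radii, [II] p. 15)
  (hbigo : ∀ (k : ℕ) (Z : (domSys (F.P K) M (k + 1)).Dom), IsOpen (big (k + 1) Z))
  (hκ₁ : 1 ≤ c.κ₁) (hα₆ : c.α₆ ≠ 0)
  -- (2.18): the τ-radii on every fine torus of the catalogue; PER-DOMAIN open τ-regions at every level; the contour radii of the data
  (hpos : ∀ k : ℕ, ∀ Y : TDom (F.P K).d (L * domCount (F.P K) M (k + 1)),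
    0 < invTau c ((tsys (F.P K).d (L * domCount (F.P K) M (k + 1))).dj Y))
  (hhalf : ∀ k : ℕ, ∀ Y : TDom (F.P K).d (L * domCount (F.P K) M (k + 1)),
    invTau c ((tsys (F.P K).d (L * domCount (F.P K) M (k + 1))).dj Y) ≤ 1 / 2)
  {Uτ : (k : ℕ) → TDom (F.P K).d (L * domCount (F.P K) M (k + 1)) → Set ℂ} (hUτ : ∀ k Y, IsOpen (Uτ k Y))
  (hUtau : ∀ k : ℕ, ∀ Y : TDom (F.P K).d (L * domCount (F.P K) M (k + 1)),
    closedBall (0 : ℂ) ((invTau c ((tsys (F.P K).d (L * domCount (F.P K) M (k + 1))).dj Y))⁻¹) ⊆ Uτ k Y)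
  (hr : ∀ k : ℕ, 0 < (𝔇 k).r) (hr' : ∀ k : ℕ, (𝔇 k).r ≤ Real.exp c.κ₁ - 1)
  (hsubτ : ∀ k : ℕ, ∀ Y, ∀ x ∈ Set.uIcc (0 : ℝ) 1, closedBall (x : ℂ) (𝔇 k).r ⊆ Uτ k Y)
  -- NODE A ∕ NODE O's (v): ONE admissible small package `w`, PER TERM a walk record of the kernels at `c⁺`; the READING MAPS holomorphic into the `α`-ball
  {w : WalkConsts} {α Rσ₀ θ : ℝ} (hw : w.Admissible α Rσ₀) (hα : 0 < α) (hsm : SmallTheta w α θ)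
  (hχ0 : ∀ (k : ℕ) (Z : (domSys (F.P K) M (k + 1)).Dom) (t : TermLabel (F.P K) M k L), ∀ s ∈ D, ∀ B, 0 ≤ (𝔇 k).chiY₀ Z t s B)
  (hχc0 : ∀ (k : ℕ) (Z : (domSys (F.P K) M (k + 1)).Dom) (t : TermLabel (F.P K) M k L), ∀ s ∈ D, ∀ B, 0 ≤ (𝔇 k).chicP Z t s B)
  (hχm : ∀ (k : ℕ) (Z : (domSys (F.P K) M (k + 1)).Dom) (t : TermLabel (F.P K) M k L), ∀ s ∈ D, Measurable ((𝔇 k).chiY₀ Z t s))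
  (hχcm : ∀ (k : ℕ) (Z : (domSys (F.P K) M (k + 1)).Dom) (t : TermLabel (F.P K) M k L), ∀ s ∈ D, Measurable ((𝔇 k).chicP Z t s))
  -- NODE O: entrywise σ-holomorphy of the kernels at the configurations of the table on the open `e^{κ₁+1}`-polydisc; NODE A: symmetry ∕ `Re ≻ 0` there
  (hAhol : ∀ (k : ℕ) (Z : (domSys (F.P K) M (k + 1)).Dom), ∀ φ ∈ big (k + 1) Z, ∀ t ∈ terms L M Z,
    ∀ i j, DifferentiableOn ℂ (fun σ => (𝔇 k).A Z t φ σ i j) {σ | ∀ j, σ j ∈ ball (0 : ℂ) (Real.exp (c.κ₁ + 1))})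
  (hGhol : ∀ (k : ℕ) (Z : (domSys (F.P K) M (k + 1)).Dom), ∀ φ ∈ big (k + 1) Z, ∀ t ∈ terms L M Z,
    ∀ i j, DifferentiableOn ℂ (fun σ => ((𝔇 k).𝒦 Z t).G2 σ ((𝔇 k).uOf Z t φ) i j) {σ | ∀ j, σ j ∈ ball (0 : ℂ) (Real.exp (c.κ₁ + 1))})
  (hAs : ∀ (k : ℕ) (Z : (domSys (F.P K) M (k + 1)).Dom), ∀ φ ∈ big (k + 1) Z, ∀ t ∈ terms L M Z,
    ∀ σ : TPt (F.P K).d (domCount (F.P K) M (k + 1)) → ℂ, (∀ j, ‖σ j‖ ≤ Real.exp (c.κ₁ + 1)) → ((𝔇 k).A Z t φ σ).IsSymm)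
  (hA : ∀ (k : ℕ) (Z : (domSys (F.P K) M (k + 1)).Dom), ∀ φ ∈ big (k + 1) Z, ∀ t ∈ terms L M Z,
    ∀ σ : TPt (F.P K).d (domCount (F.P K) M (k + 1)) → ℂ, (∀ j, ‖σ j‖ ≤ Real.exp (c.κ₁ + 1)) → (((𝔇 k).A Z t φ σ).map Complex.re).PosDef)
  -- LEMMA 2 ALONG THE HISTORY ([II] (1.41), p. 15), under the (1.18) guard: potentials holomorphic IN φ on the open table, measurable, (2.20) on `Π_Y Uτ k Y`
  (hVholφ : ∀ k : ℕ, ∀ s ∈ D, ∀ old : OlderTerms (F.P K) 𝔸 M k,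
    (∀ (j : Fin (k + 1)) (Y : (domSys (F.P K) M j).Dom), ∀ ψ ∈ sp j Y,
        ‖old j Y ψ‖ ≤ E₀ * Real.exp (-(r₁ * (domSys (F.P K) M j).dj Y))) →
    (∀ (j : Fin (k + 1)) (Y : (domSys (F.P K) M j).Dom), AnalyticOnNhd ℂ (old j Y) (sp j Y)) →
    ∀ (Z : (domSys (F.P K) M (k + 1)).Dom), ∀ t ∈ terms L M Z,
      ∀ Y B, DifferentiableOn ℂ (fun φ => (𝔇 k).𝒱 Z t s old φ Y B) (big (k + 1) Z))
  (hVm : ∀ k : ℕ, ∀ s ∈ D, ∀ old : OlderTerms (F.P K) 𝔸 M k,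
    (∀ (j : Fin (k + 1)) (Y : (domSys (F.P K) M j).Dom), ∀ ψ ∈ sp j Y,
        ‖old j Y ψ‖ ≤ E₀ * Real.exp (-(r₁ * (domSys (F.P K) M j).dj Y))) →
    (∀ (j : Fin (k + 1)) (Y : (domSys (F.P K) M j).Dom), AnalyticOnNhd ℂ (old j Y) (sp j Y)) →
    ∀ (Z : (domSys (F.P K) M (k + 1)).Dom), ∀ φ ∈ big (k + 1) Z, ∀ t ∈ terms L M Z, ∀ Y, Measurable ((𝔇 k).𝒱 Z t s old φ Y))
  {γ₂ rP a₂₀ w₂₀ : ℝ} (hγ₂ : 0 ≤ γ₂) (ha0 : 0 ≤ a₂₀)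
  (qP : (k : ℕ) → (Z : (domSys (F.P K) M (k + 1)).Dom) → (t : TermLabel (F.P K) M k L) → (((𝔇 k).𝒦 Z t).Λ → ℝ) → ℝ)
  (hqP : ∀ (k : ℕ) (Z : (domSys (F.P K) M (k + 1)).Dom) (t : TermLabel (F.P K) M k L) (B : ((𝔇 k).𝒦 Z t).Λ → ℝ), qP k Z t B ≤ B ⬝ᵥ B)
  (h222 : ∀ (k : ℕ) (Z : (domSys (F.P K) M (k + 1)).Dom) (t : TermLabel (F.P K) M k L), ∀ s ∈ D, ∀ B : ((𝔇 k).𝒦 Z t).Λ → ℝ,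
    (𝔇 k).chiY₀ Z t s B * (𝔇 k).chicP Z t s B ≤ Real.exp (-(γ₂ / 2 * rP ^ 2 * (t.2.card : ℕ)) + γ₂ / 2 * qP k Z t B))
  (h220U : ∀ k : ℕ, ∀ s ∈ D, ∀ old : OlderTerms (F.P K) 𝔸 M k,
    (∀ (j : Fin (k + 1)) (Y : (domSys (F.P K) M j).Dom), ∀ ψ ∈ sp j Y,
        ‖old j Y ψ‖ ≤ E₀ * Real.exp (-(r₁ * (domSys (F.P K) M j).dj Y))) →
    (∀ (j : Fin (k + 1)) (Y : (domSys (F.P K) M j).Dom), AnalyticOnNhd ℂ (old j Y) (sp j Y)) →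
    ∀ (Z : (domSys (F.P K) M (k + 1)).Dom), ∀ φ ∈ big (k + 1) Z, ∀ t ∈ terms L M Z,
      ∀ τ : TDom (F.P K).d (L * domCount (F.P K) M (k + 1)) → ℂ, (∀ Y, τ Y ∈ Uτ k Y) →
        ∀ B : ((𝔇 k).𝒦 Z t).Λ → ℝ, ∑ Y ∈ t.1, ‖τ Y‖ * ‖(𝔇 k).𝒱 Z t s old φ Y B‖ ≤ a₂₀ / 2 * (B ⬝ᵥ B) + w₂₀)
  -- a common fibre bound for the row and column locations of every kernel record
  {m : ℕ} (hm : ∀ (k : ℕ) (Z : (domSys (F.P K) M (k + 1)).Dom) (t : TermLabel (F.P K) M k L), ((𝔇 k).𝒦 Z t).m ≤ m)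
  (hfibN : ∀ (k : ℕ) (Z : (domSys (F.P K) M (k + 1)).Dom) (t : TermLabel (F.P K) M k L) (x : UT (𝔇 k).Nf),
    (Finset.univ.filter fun j => ((𝔇 k).𝒦 Z t).locN j = x).card ≤ m)
  -- rates: the package's torus rate `w.κ`, two drops for (L16a), two more for the (2.26) chain; the record-letter numerics (T25's, per term)
  {κa κb kap' kap'' : ℝ} (hκa : κa < w.kap) (hκb : κb < κa) (h2 : kap' < κb) (h1 : kap'' < kap') (hkap'' : 0 < kap'')
  (hθR1le : ∀ (k : ℕ) (Z : (domSys (F.P K) M (k + 1)).Dom) (t : TermLabel (F.P K) M k L),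
    (m * (1 + 2 / (κb - kap')) ^ (𝔇 k).ν) * (m * (1 + 2 / (kap' - kap'')) ^ (𝔇 k).ν)
      * ((2 * w.KbarΓ * Real.exp (-(w.ε * w.Rσ)) + 2 * w.KbarΓ * α / w.R) * w.KbarC * w.KbarΓ
        + w.KbarΓ * (w.KbarC * (2 * w.KbarE * Real.exp (-(w.ε * w.Rσ)) + 2 * w.KbarE * α / w.R)
            * (((𝔇 k).𝒦 Z t).m * (1 + 2 / (w.kap - κa)) ^ (𝔇 k).ν) * w.KbarC * (((𝔇 k).𝒦 Z t).m * (1 + 2 / (κa - κb)) ^ (𝔇 k).ν))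
            * w.KbarΓ
        + w.KbarΓ * w.KbarC * (2 * w.KbarΓ * Real.exp (-(w.ε * w.Rσ)) + 2 * w.KbarΓ * α / w.R)) ≤ θ)
  (hsmallKθ : ∀ k : ℕ, w.KbarC * (m * (1 + 2 / κb) ^ (𝔇 k).ν) * (θ * (m * (1 + 2 / kap'') ^ (𝔇 k).ν)) < 1)
  {cE g : ℝ} (hc0 : 0 ≤ cE)
  (hc : ∀ (k : ℕ) (Z : (domSys (F.P K) M (k + 1)).Dom) (t : TermLabel (F.P K) M k L) (i : ((𝔇 k).𝒦 Z t).Λ),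
    ((𝔇 k).𝒦 Z t).hC.1.eigenvalues i ≤ cE)
  (hαc : ∀ k : ℕ, (2 * (θ * (m * (1 + 2 / kap'') ^ (𝔇 k).ν)) + (γ₂ + a₂₀)) * cE ≤ 1 / 2) (hg : 0 ≤ g)
  (hΓq : ∀ (k : ℕ) (Z : (domSys (F.P K) M (k + 1)).Dom) (t : TermLabel (F.P K) M k L) (X : ((𝔇 k).𝒦 Z t).Λ ⊕ ((𝔇 k).𝒦 Z t).C₀ → ℝ),
    (((𝔇 k).𝒦 Z t).Γ₀ *ᵥ X) ⬝ᵥ (((𝔇 k).𝒦 Z t).C *ᵥ (((𝔇 k).𝒦 Z t).Γ₀ *ᵥ X)) ≤ g * (X ⬝ᵥ X))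
  (hsmall : ∀ k : ℕ, (2 * (θ * (m * (1 + 2 / kap'') ^ (𝔇 k).ν)) + (γ₂ + a₂₀)) * (1 + 2 * cE * g) ≤ 1 / 2)
  {a a₅ : ℝ} (hPa : a ≤ γ₂ * rP ^ 2)
  (hvol : ∀ (k : ℕ) (Z : (domSys (F.P K) M (k + 1)).Dom) (t : TermLabel (F.P K) M k L),
    2 * (w.KbarC * (m * (1 + 2 / κb) ^ (𝔇 k).ν) * (θ * (m * (1 + 2 / kap'') ^ (𝔇 k).ν))
            * (1 + (1 - w.KbarC * (m * (1 + 2 / κb) ^ (𝔇 k).ν) * (θ * (m * (1 + 2 / kap'') ^ (𝔇 k).ν)))⁻¹) / 2)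
        * (Fintype.card ((𝔇 k).𝒦 Z t).Λ : ℝ)
      + w₂₀ + (2 * (θ * (m * (1 + 2 / kap'') ^ (𝔇 k).ν)) + (γ₂ + a₂₀)) * cE * (Fintype.card ((𝔇 k).𝒦 Z t).Λ : ℝ)
      + (2 * (θ * (m * (1 + 2 / kap'') ^ (𝔇 k).ν)) + (γ₂ + a₂₀)) * (1 + 2 * cE * g)
        * (Fintype.card (((𝔇 k).𝒦 Z t).Λ ⊕ ((𝔇 k).𝒦 Z t).C₀) : ℝ)
      ≤ a₅ * ((Z.1).card : ℝ))

include hbigo hκ₁ hα₆ hpos hhalf hUτ hUtau hr hr' hsubτ hw hα hsm hχ0 hχc0 hχm hχcm hAhol hGhol hAs hA hVholφ hVm hγ₂ ha0 hqP h222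
  h220U hm hfibN hκa hκb h2 h1 hkap'' hθR1le hsmallKθ hc0 hc hαc hg hΓq hsmall hPa hvol

/-- **(T-an) ∧ (T-226) FOR `𝔇.TF` ALONG THE HISTORY ON THE OPEN LOCATED-INPUTS TABLES, FROM THE WALK RECORDS AND THE READING MAPS** (§1 at `V := big (k+1) Z`
per step, coupling `g ∈ D`, older-term table in the guard class, `Z` and term).
[cite: Balaban1988RG2Cluster, (2.14) p.15 and the analyticity statement p.15, p.13, (2.26) p.17, (1.41) p.11; Balaban1985BackgroundPropagators, Thm 3.10 p.416] -/
theorem holAnd226_TF_of_termWalkData (h𝒦 : ∀ (k : ℕ) (Z : (domSys (F.P K) M (k + 1)).Dom), ∀ t ∈ terms L M Z, TermWalkData ((𝔇 k).𝒦 Z t) w)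
    (huOf : ∀ (k : ℕ) (Z : (domSys (F.P K) M (k + 1)).Dom), ∀ t ∈ terms L M Z, DifferentiableOn ℂ ((𝔇 k).uOf Z t) (big (k + 1) Z))
    (hmaps : ∀ (k : ℕ) (Z : (domSys (F.P K) M (k + 1)).Dom), ∀ t ∈ terms L M Z,
      MapsTo ((𝔇 k).uOf Z t) (big (k + 1) Z) (ball (0 : (𝔇 k).E₃) α)) :
    ∀ k : ℕ, ∀ s ∈ D, ∀ old : OlderTerms (F.P K) 𝔸 M k,
      (∀ (j : Fin (k + 1)) (Y : (domSys (F.P K) M j).Dom), ∀ ψ ∈ sp j Y,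
          ‖old j Y ψ‖ ≤ E₀ * Real.exp (-(r₁ * (domSys (F.P K) M j).dj Y))) →
      (∀ (j : Fin (k + 1)) (Y : (domSys (F.P K) M j).Dom), AnalyticOnNhd ℂ (old j Y) (sp j Y)) →
      ∀ (Z : (domSys (F.P K) M (k + 1)).Dom), ∀ t ∈ terms L M Z,
        DifferentiableOn ℂ (fun φ => 𝔇.TF k Z t s old φ) (big (k + 1) Z) ∧
          ∀ φ ∈ big (k + 1) Z, ‖𝔇.TF k Z t s old φ‖ ≤ weight L M c Z a t * Real.exp (a₅ * ((Z.1).card : ℝ)) := by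
  intro k s hs old hB hAn Z t ht
  rw [TermData214.TF_apply]
  exact holAnd226_TF_of_termWalkData_param (𝔇 k) hκ₁ hα₆ Z t s old (hbigo k Z) (hpos k) (hhalf k) (hUτ k) (hUtau k) (hr k) (hr' k)
    (hsubτ k) hw hα (hχ0 k Z t s hs) (hχc0 k Z t s hs) (hχm k Z t s hs) (hχcm k Z t s hs)
    (fun φ hφ => hAhol k Z φ hφ t ht) (fun φ hφ => hGhol k Z φ hφ t ht) (fun φ hφ => hAs k Z φ hφ t ht) (fun φ hφ => hA k Z φ hφ t ht)
    (hVholφ k s hs old hB hAn Z t ht) (fun φ hφ => hVm k s hs old hB hAn Z φ hφ t ht) (qP k Z t) (h222 k Z t s hs) hγ₂ (hqP k Z t) ha0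
    (fun φ hφ => h220U k s hs old hB hAn Z φ hφ t ht) (hm k Z t) (hfibN k Z t) hκa hκb h2 h1 hkap'' hsm (hθR1le k Z t) (hsmallKθ k) hc0
    (hc k Z t) (hαc k) hg (hΓq k Z t) (hsmall k) hPa (hvol k Z t) (h𝒦 k Z t ht) (huOf k Z t ht) (hmaps k Z t ht)

/-- **★★ (T-an) FOR `𝔇.TF` ALONG THE HISTORY — file 23's `hTan` BINDER — FROM NODE A's WALK RECORDS READ AT THE CONFIGURATION**, on every table family
`sp₁ ⊆ big` (file 23: `sp₁ := sp`; file 24's pair: `sp₁ := sp′`): one package `w`, a walk record and a reading map per term, σ-holomorphy, symmetry ∕ `Re ≻ 0`,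
LEMMA 2 along the history, `χχᶜ` with (2.22), the record-letter numerics ⟹ print's «analytic function of (𝐔, 𝐉)» ([II] p. 15) for every term at every step.
[cite: Balaban1988RG2Cluster, (2.14) p.15 and the analyticity statement p.15, p.13; Balaban1985BackgroundPropagators, Thm 3.10 p.416; Chae1985, Thm 14.13] -/
theorem termwiseAn_TF_of_termWalkData (h𝒦 : ∀ (k : ℕ) (Z : (domSys (F.P K) M (k + 1)).Dom), ∀ t ∈ terms L M Z, TermWalkData ((𝔇 k).𝒦 Z t) w)
    (huOf : ∀ (k : ℕ) (Z : (domSys (F.P K) M (k + 1)).Dom), ∀ t ∈ terms L M Z, DifferentiableOn ℂ ((𝔇 k).uOf Z t) (big (k + 1) Z))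
    (hmaps : ∀ (k : ℕ) (Z : (domSys (F.P K) M (k + 1)).Dom), ∀ t ∈ terms L M Z,
      MapsTo ((𝔇 k).uOf Z t) (big (k + 1) Z) (ball (0 : (𝔇 k).E₃) α))
    (sp₁ : (j : ℕ) → (domSys (F.P K) M j).Dom → Set (CPair (F.P K) 𝔸))
    (hsub : ∀ (k : ℕ) (Z : (domSys (F.P K) M (k + 1)).Dom), sp₁ (k + 1) Z ⊆ big (k + 1) Z) :
    ∀ k : ℕ, ∀ s ∈ D, ∀ old : OlderTerms (F.P K) 𝔸 M k,
      (∀ (j : Fin (k + 1)) (Y : (domSys (F.P K) M j).Dom), ∀ ψ ∈ sp j Y,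
          ‖old j Y ψ‖ ≤ E₀ * Real.exp (-(r₁ * (domSys (F.P K) M j).dj Y))) →
      (∀ (j : Fin (k + 1)) (Y : (domSys (F.P K) M j).Dom), AnalyticOnNhd ℂ (old j Y) (sp j Y)) →
      ∀ (Z : (domSys (F.P K) M (k + 1)).Dom), ∀ t ∈ terms L M Z, AnalyticOnNhd ℂ (fun φ => (𝔇 k).TF Z t s old φ) (sp₁ (k + 1) Z) := by
  intro k s hs old hB hAn Z t ht
  have h := (holAnd226_TF_of_termWalkData F K L 𝔇 D sp big hbigo hκ₁ hα₆ hpos hhalf hUτ hUtau hr hr' hsubτ hw hα hsm hχ0 hχc0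
    hχm hχcm hAhol hGhol hAs hA hVholφ hVm hγ₂ ha0 qP hqP h222 h220U hm hfibN hκa hκb h2 h1 hkap'' hθR1le hsmallKθ hc0 hc hαc hg hΓq hsmall hPa
    hvol h𝒦 huOf hmaps k s hs old hB hAn Z t ht).1
  rw [TermData214.TF_apply] at h
  exact (analyticOnNhd_of_differentiableOn h (hbigo k Z)).mono (hsub k Z)

/-- **★ node00-def-W1's `RecAdmissible` FOR THE DATUM's GENERATOR `𝔇.Gn = GenTower.ofTerms L 𝔇.TF` FROM NODE A's WALK RECORDS READ AT THE CONFIGURATION**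
(file 23 `recAdmissible_ofTerms_of_termwise`, `hTan :=` §2 `termwiseAn_TF_of_termWalkData` at `sp₁ := sp`, `hT226 :=` the (2.26) half of
`holAnd226_TF_of_termWalkData` on `sp ⊆ big`): along every history with values in `D` the generated older terms lie in the class «(1.18)`(E₀,r₁)` on the tables +
analytic there» — the guard of LEMMA 2's inputs: THE INDUCTION CLOSES from the walk records, the reading maps, σ-holomorphy, symmetry ∕ `Re ≻ 0`, Lemma 2's
letters, `χχᶜ` with (2.22), the record-letter numerics and Lemma 3's numerics at `c` (`8 ≤ c.L = L`, strict Kotecký–Preiss, renewal `e·9·64·K₀²·C₃ε₁ ≤ E₀`).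
[cite: Balaban1987RG1, (1.18) p.263 and Thm 1 p.259; Balaban1988RG2Cluster, (1.41) p.11, p.13, (2.14) p.15, (2.26) p.17, Lemma 3 (2.38) p.20, p.22; Balaban1985BackgroundPropagators, Thm 3.10 p.416] -/
theorem recAdmissible_Gn_of_termWalkData (h𝒦 : ∀ (k : ℕ) (Z : (domSys (F.P K) M (k + 1)).Dom), ∀ t ∈ terms L M Z, TermWalkData ((𝔇 k).𝒦 Z t) w)
    (huOf : ∀ (k : ℕ) (Z : (domSys (F.P K) M (k + 1)).Dom), ∀ t ∈ terms L M Z, DifferentiableOn ℂ ((𝔇 k).uOf Z t) (big (k + 1) Z))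
    (hmaps : ∀ (k : ℕ) (Z : (domSys (F.P K) M (k + 1)).Dom), ∀ t ∈ terms L M Z,
      MapsTo ((𝔇 k).uOf Z t) (big (k + 1) Z) (ball (0 : (𝔇 k).E₃) α))
    (hrestr : ∀ k, W1.SpRestr (sp (k + 1))) (hL8 : 8 ≤ c.L) (hLc : c.L = L)
    {a₂ a₂' Aabs : ℝ} (hN : Lemma3Numerics c M ((c.L : ℝ) / 2) a a₂ a₂' a₅ Aabs)
    (hbig : ∀ (k : ℕ) (Z : (domSys (F.P K) M (k + 1)).Dom), sp (k + 1) Z ⊆ big (k + 1) Z)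
    (hr₁ : 0 ≤ r₁) (hApos : 0 ≤ c.C3act * c.ε₁) (hrate : r₁ + 2 * (64 * Real.log 162) + 2 ≤ (1 - 8 * c.δ) * ((c.L : ℝ) / 2) * c.κ)
    (hKP : c.C3act * c.ε₁ * Real.exp (5 * r₁ + 1) * K₀ 64 8 * 9 * 64 < 1)
    (hrenew : Real.exp 1 * 9 * 64 * K₀ 64 8 ^ 2 * (c.C3act * c.ε₁) ≤ E₀) :
    RecAdmissible 𝔇.Gn D fun k => {old : OlderTerms (F.P K) 𝔸 M k |
      (∀ (j : Fin (k + 1)) (Y : (domSys (F.P K) M j).Dom), ∀ ψ ∈ sp j Y,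
          ‖old j Y ψ‖ ≤ E₀ * Real.exp (-(r₁ * (domSys (F.P K) M j).dj Y))) ∧
      (∀ (j : Fin (k + 1)) (Y : (domSys (F.P K) M j).Dom), AnalyticOnNhd ℂ (old j Y) (sp j Y))} :=
  recAdmissible_ofTerms_of_termwise F K L 𝔇.TF D sp hrestr c hL8 hLc hN
    (termwiseAn_TF_of_termWalkData F K L 𝔇 D sp big hbigo hκ₁ hα₆ hpos hhalf hUτ hUtau hr hr' hsubτ hw hα hsm hχ0 hχc0 hχm hχcm
      hAhol hGhol hAs hA hVholφ hVm hγ₂ ha0 qP hqP h222 h220U hm hfibN hκa hκb h2 h1 hkap'' hθR1le hsmallKθ hc0 hc hαc hg hΓq hsmall hPa hvol h𝒦 huOf hmaps sp hbig)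
    (fun k s hs old hB hAn Z φ hφ t ht =>
      (holAnd226_TF_of_termWalkData F K L 𝔇 D sp big hbigo hκ₁ hα₆ hpos hhalf hUτ hUtau hr hr' hsubτ hw hα hsm hχ0 hχc0 hχm hχcm
        hAhol hGhol hAs hA hVholφ hVm hγ₂ ha0 qP hqP h222 h220U hm hfibN hκa hκb h2 h1 hkap'' hθR1le hsmallKθ hc0 hc hαc hg hΓq hsmall hPa hvol
        h𝒦 huOf hmaps k s hs old hB hAn Z t ht).2 φ (hbig k Z hφ))
    hr₁ hApos hrate hKP hrenew

end Located

end Summit.QuantumFields.YangMills.BalabanUVNodes.N18HLayerW1TermWalkRecord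

end
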